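import Summits.BirchSwinnertonDyer.BirchSwinnertonDyer.Theorems.TwoAdicConverseBDPSelmerLowerDivisibilityAtTwoPurityBridgeAnyPrime
import Summits.BirchSwinnertonDyer.BirchSwinnertonDyer.Theorems.SignedBaseChangeAnticyclotomicEisensteinDivisibilityNoPseudoNullOfFacts
import Literature.NumberTheory.DiophantineGeometry.LocalReductionFiniteBadPlacesProofs
import HarnessLib

/-!
# `X_Gr(E/K̃_∞)` has no non-zero pseudo-null `Λ₂`-submodule at EVERY split prime, granted ONLY the six published
# facts of Greenberg 2016 / 2006 and `Λ₂`-torsion — the bsd-ssimc Greenberg road (`SignedBaseChangeAcDiv…`,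
# `2 < p`) re-run parity-free, for O2's piece P1 PURITY₂ at `p = 2`
# (helper for stmt-BirchSwinnertonDyer-24728 `BDPSelmerLowerDivisibilityAtTwo`; closes nothing)

Cell `bsd-2adic`, seat `bsd-2adic-tower-1` GEN 48 (SUMMON key «PURITY₂», director-bsd (532)(a); pen RC-572/573).
Node `residual-selmer-control-two` (crux-ideate seat 2, O2 = stmt-BirchSwinnertonDyer-24728) displays the piece
P1 `PurityAtTwo`: "if `X_Gr₂(E/K̃_∞)` at `2` is `Λ₂`-torsion then it has no non-zero pseudo-null `Λ₂`-submodule —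
Greenberg 2016 Prop. 4.1.1 (c) with `η = v` the relaxed prime". The tree ALREADY holds that road for an elliptic
`W/K`, `K` imaginary quadratic and `2 < p = v v̄` split (cell bsd-ssimc, crux `AnticyclotomicEisensteinDivisibility`):
`SignedBaseChangeAcDivNoPseudoNullOfFacts.xGr₂_hasNoPseudoNullSubmodule_of_facts (hp : 2 < p)` — GRANTED ONLY the
six PUBLISHED facts by name (Greenberg 2016 Props. 4.1.1 / 4.2.2, Greenberg 2006 Props. 3.2 / 4.1 / 4.2 / §5 A) and
the `Λ₂`-torsion of `X_Gr₂`, LEO and CRK being DERIVED from torsion by the corank squeeze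
`SignedBaseChangeAcDivGreenbergSqueeze.leo_and_crk_fullAt_of_squeeze` (Greenberg's identity
`s_𝓛 = b₁ − q_𝓛 + c_𝓛 + corank Ш²` with `b₁ = q_𝓛 = rank_{ℤ_p} T_pE` at an imaginary quadratic `K` with `p` split
— no weak-Leopoldt input). Its ONE use of `2 < p` sits in the Shapiro bridge, re-run parity-free in
`TwoAdicConverseBDPSelmerLowerDivisibilityAtTwoPurityBridgeAnyPrime` (§1–§2 there). THIS FILE re-runs the rest
of the chain on that bridge, binder for binder, `2 < p` DELETED:

* §3 `fullAtSelmer_isAlmostDivisible_curve_anyPrime`, `xGr₂_hasNoPseudoNullSubmodule_curve_anyPrime` —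
  Greenberg 2016 Prop. 4.1.1 (c) at `𝐃 = Ind_{K̃_∞/K}(E_K[p^∞])`, `𝓛_v` = (everything at `v`, `0` at every other
  `w ∈ Σ`), `η = v` (twins of `SignedBaseChangeAcDivAssembly.…_curve`): RFX / cofree / corank / `p`-primarity of
  `𝐃` (`IndModule₂.isCofree`, `.rfx`, `.hasCorank`), LOC⁽²⁾ on `Σ` (`loc2_of_loc1_of_free`; complex places
  `loc2_inl_of_isComplex`), `𝓛_v` stable / almost divisible / clause (c) (`fullAtSelmer_isAlmostDivisible_of_facts`),
  LEO ∧ CRK (the squeeze) — all DISCHARGED; displayed: the six facts, torsion, bricks (R1a)/(R1b).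
* §4 `xGr₂_hasNoPseudoNullSubmodule_of_bricks_anyPrime` (arena chosen inside: `S = {w ∣ p} ∪` bad places, the
  descended `ρ₀`, discrete topologies) and ★ `xGr₂_hasNoPseudoNullSubmodule_of_facts_anyPrime` — for `W/K`
  elliptic, `K` imaginary quadratic, ANY prime `p = v v̄` split in `K`, a generator pair: `Λ₂`-torsion of
  `X_Gr₂ = W.XGr₂ p κ₁ κ₂ v̄ γ₁ γ₂` ⟹ no non-zero pseudo-null `Λ₂`-submodule, GRANTED ONLY the six published facts
  ((R1a) `SignedBaseChangeAcDivCofree.isCofree_primaryTorsion` / `exists_tateDual_basis_primaryTorsion` and (R1b)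
  `SignedBaseChangeAcDivTwistLOC1.loc1_and_hasCorank_H0_zero_curve` are parity-free tree theorems).

WHY PRINT COVERS `p = 2`: Greenberg 2016 Prop. 4.1.1 and Greenberg 2006 ("We allow `p` to be any prime", p. 341;
"The archimedean primes are only an issue when `p = 2`", 2016 p. 18) are typed for every `p`; at a totally
imaginary `K` the archimedean clause LOC_v⁽²⁾ is `loc2_inl_of_isComplex`. Disjunct (c) of Prop. 4.1.1 carries NO
hypothesis on `𝐃[𝔪]` (the `μ_p`-clauses are disjuncts (a)/(b)), so `E[2]` reducible is harmless here.
NOT COVERED (honest): `p` inert or ramified in `K` — then `unrSelmer₂ … v̄` is the everywhere-unramified group,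
SUR/CRK fail (`corank Q_𝓛 = 2·rank T_pE > rank T_pE = corank H¹(K_Σ/K, 𝐃)`) and Prop. 4.1.1 does not apply; every
theorem here carries the split pair `v ≠ v̄`.

Theorems only; no definition, no named fact, no instance, no `sorry`. HONEST FRAMING: CONDITIONAL on the six
PUBLISHED named facts taken as hypotheses; closes nothing (`--supports stmt-BirchSwinnertonDyer-24728`); no summit
statement / BSD / O2 is proved by this file; typed ≠ proved.

References: [Greenberg2016Selmer] R. Greenberg, *On the structure of Selmer groups*, PROMS 188 (2016),
Prop. 4.1.1 (c) p. 15, Prop. 4.2.2 p. 20, §4.3 pp. 20–21, p. 18 L4–16; [Greenberg2006] Doc. Math. Extra Vol.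
Coates (2006), Thm. 3 p. 342, Props. 3.2 / 4.1 / 4.2 / 4.3, §5 A, p. 341 L24; [Greenberg2010] Lemma 5.2.2;
[SilvermanAEC2009] VII.4.1, VIII.1 Rem. 1.3; [BurungaleCastellaSkinner2025] §2.1 p. 6 (`X_Gr(E/K_∞)`).
-/

-- `Summit.BirchSwinnertonDyer.BirchSwinnertonDyer.…`: summit and sub-problem share a name (D-0017 layout).
set_option linter.dupNamespace false
set_option autoImplicit false

noncomputable section

open scoped Classical
open NumberField IsDedekindDomain Field
open Literature.NumberTheory.EllipticCurves Literature.NumberTheory.GaloisRepresentations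
  Literature.NumberTheory.EllipticCurves.Rubin1991
  Literature.NumberTheory.IwasawaTheory Literature.NumberTheory.IwasawaTheory.Greenberg2006
  Literature.NumberTheory.IwasawaTheory.Greenberg2016
  Summit.BirchSwinnertonDyer.BirchSwinnertonDyer.Theorems.GreenbergFullAtSelmer
  Summit.BirchSwinnertonDyer.BirchSwinnertonDyer.Theorems.TwistDeformationCofree
  Summit.BirchSwinnertonDyer.BirchSwinnertonDyer.Theorems.SignedBaseChangeAcDivFiniteExponent
  Summit.BirchSwinnertonDyer.BirchSwinnertonDyer.Theorems.SignedBaseChangeAcDivGreenbergSqueeze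
  Summit.BirchSwinnertonDyer.BirchSwinnertonDyer.Theorems.SignedBaseChangeAcDivCurveModel
  Summit.BirchSwinnertonDyer.BirchSwinnertonDyer.Theorems.SignedBaseChangeAcDivCofree
  Summit.BirchSwinnertonDyer.BirchSwinnertonDyer.Theorems.SignedBaseChangeAcDivTwistLOC1

namespace Summit.BirchSwinnertonDyer.BirchSwinnertonDyer.Theorems.TwoAdicBDPPurity

/-! ## §3 Greenberg 2016 Prop. 4.1.1 (c) at `𝐃 = Ind_{K̃_∞/K}(E_K[p^∞])`, every split `p` -/

section Assembly

variable {K : Type} [Field K] [NumberField K] {S : Set (HeightOneSpectrum (𝓞 K))} {p : ℕ}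
  [Fact p.Prime] (W : WeierstrassCurve K)
  [TopologicalSpace (PowerSeries ℤ_[p])] [TopologicalSpace (PowerSeries (PowerSeries ℤ_[p]))]
  [IsTopologicalRing (PowerSeries (PowerSeries ℤ_[p]))]
  [IsTopologicalAddGroup (IndModule₂ ℤ_[p] p (PrimaryTorsion W.geomPoints p))]
  [ContinuousSMul (PowerSeries (PowerSeries ℤ_[p])) (IndModule₂ ℤ_[p] p (PrimaryTorsion W.geomPoints p))]
  (hS : ∀ v : HeightOneSpectrum (𝓞 K), ((p : ℕ) : 𝓞 K) ∈ v.asIdeal → v ∈ S)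
  (κ₁ κ₂ : ZpExtension K p)
  (ρ₀ : ContinuousRep (GaloisGroupUnramifiedOutside K S) ℤ_[p] (PrimaryTorsion W.geomPoints p))
  (vbar : HeightOneSpectrum (𝓞 K)) (γ₁ γ₂ : absoluteGaloisGroup K)
  [hγ : Fact (ZpExtension.IsTopGeneratorPair κ₁ κ₂ γ₁ γ₂)]

/-- **Greenberg 2016 Prop. 4.1.1 (c) at `𝐃 = Ind_{K̃_∞/K}(E_K[p^∞])`, EVERY split prime: `S_{𝓛_v}(K, 𝐃)` is
almost divisible**, granted the six PUBLISHED facts (by name), the `Λ₂`-torsion of `X_Gr₂`, and the two instance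
bricks `hcofree`/`hTate` and `hLOC1`/`h0loc`/`h0`; LEO and CRK by the corank squeeze at corank
`m = rank_{ℤ_p} Hom(E[p^∞], ℚ/ℤ)`, clause (c) at `η = v`. Twin of
`SignedBaseChangeAcDivAssembly.fullAtSelmer_isAlmostDivisible_curve` (the parity-free bridge
`exists_addEquiv_unrSelmer₂_balanced_curve_anyPrime` replacing the `2 < p` one).
[cite: Greenberg2016Selmer, Prop. 4.1.1 (c) (§4.1 p. 15 L21–32), §4.3 p. 20 L19–30]
[cite: Greenberg2006, Props. 3.2, 4.1, 4.2, 4.3, §5 A; Thm. 3 p. 342] [cite: Greenberg2010, Lemma 5.2.2] -/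
theorem fullAtSelmer_isAlmostDivisible_curve_anyPrime
    (h411 : prop411_selmer_isAlmostDivisible) (h422 : prop422_localCohomology_isAlmostDivisible)
    (h5A : sec5A_localH2_subsingleton_of_LOC1) (h41 : prop41_globalEulerPoincareCorank)
    (h42 : prop42_localEulerPoincareCorank) (h32 : prop32_cohomology_isCofinitelyGenerated)
    (hSf : S.Finite) (hK : IsImaginaryQuadratic K)
    {v : HeightOneSpectrum (𝓞 K)} (hv : ((p : ℕ) : 𝓞 K) ∈ v.asIdeal)
    (hvbar : ((p : ℕ) : 𝓞 K) ∈ vbar.asIdeal) (hne : vbar ≠ v)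
    (hNS : ∀ n ∈ ramificationSubgroup K S, ∀ P : PrimaryTorsion W.geomPoints p, n • P = P)
    (hρ₀ : ∀ (σ : absoluteGaloisGroup K) (P : PrimaryTorsion W.geomPoints p),
      ρ₀ (toUnramifiedQuot K S σ) P = σ • P)
    -- the input: `X_Gr₂` is `Λ₂`-torsion
    (htors : Module.IsTorsion (IwasawaAlgebra₂ p) (W.XGr₂ p κ₁ κ₂ vbar γ₁ γ₂))
    -- instance brick 1: `E[p^∞]` is cofree over `ℤ_p`, with a basis of a Tate dual
    (hcofree : IsCofree ℤ_[p] (PrimaryTorsion W.geomPoints p))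
    (hTate : ∃ (Y : Type) (_ : AddCommGroup Y) (_ : Module ℤ_[p] Y)
      (tA : Y →+ (PrimaryTorsion W.geomPoints p →+ DiscreteGaloisModule.UnitsCarrier K))
      (_ : IsDualPairing ℤ_[p] (PrimaryTorsion W.geomPoints p) tA) (n : ℕ),
      Nonempty (Module.Basis (Fin n) ℤ_[p] Y))
    -- instance brick 2: LOC⁽¹⁾ and `corank H⁰ = 0` (determinant form of Greenberg 2010 Lemma 5.2.2)
    (hLOC1 : ∀ w : HeightOneSpectrum (𝓞 K), w ∈ S → LOC1 S (twistDeformation S hS κ₁ κ₂ ρ₀) (Sum.inr w))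
    (h0loc : ∀ w : HeightOneSpectrum (𝓞 K), w ∈ S →
      HasCorank (IwasawaAlgebra₂ p) ((localRep S (twistDeformation S hS κ₁ κ₂ ρ₀) (Sum.inr w)).H 0) 0)
    (h0 : HasCorank (IwasawaAlgebra₂ p) ((twistDeformation S hS κ₁ κ₂ ρ₀).H 0) 0) :
    IsAlmostDivisible (IwasawaAlgebra₂ p)
      (fullAtSpecification S (twistDeformation S hS κ₁ κ₂ ρ₀) (Sum.inr v)).selmer := by
  set ρ := twistDeformation S hS κ₁ κ₂ ρ₀ with hρ
  -- standing clauses of the arena at `Λ = R = Λ₂`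
  have hΛ := nonempty_iwasawaAlgebraTwoVar_ringEquiv_mvPowerSeries p
  have hcpl := isAdicComplete_maximalIdeal_iwasawaAlgebraTwoVar p
  have hres := finite_residueField_iwasawaAlgebraTwoVar p
  have hchar := charP_residueField_iwasawaAlgebraTwoVar p
  have hinj : Function.Injective
      (algebraMap (PowerSeries (PowerSeries ℤ_[p])) (PowerSeries (PowerSeries ℤ_[p]))) :=
    fun a b h ↦ by simpa using h
  have hfin : Module.Finite (PowerSeries (PowerSeries ℤ_[p])) (PowerSeries (PowerSeries ℤ_[p])) :=
    inferInstance
  have hlin : ∀ (g : GaloisGroupUnramifiedOutside K S) (r : PowerSeries (PowerSeries ℤ_[p]))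
      (d : IndModule₂ ℤ_[p] p (PrimaryTorsion W.geomPoints p)), ρ g (r • d) = r • ρ g d :=
    fun g r d ↦ twistDeformation_smul S hS κ₁ κ₂ ρ₀ g r d
  -- `𝐃`: cofree, cofinitely generated, `p`-primary, RFX, corank `m`
  have hA : ∀ a : PrimaryTorsion W.geomPoints p, ∃ k : ℕ, p ^ k • a = 0 := fun a ↦ by
    obtain ⟨k, hk⟩ := a.exists_pow_smul_eq_zero
    exact ⟨k, PrimaryTorsion.ext (by rw [PrimaryTorsion.val_nsmul]; exact hk)⟩
  have hT : IsCofree (PowerSeries (PowerSeries ℤ_[p])) (IndModule₂ ℤ_[p] p (PrimaryTorsion W.geomPoints p)) :=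
    IndModule₂.isCofree hA hcofree
  have hcf := IsCofree.isCofinitelyGenerated hT
  have hRFX : RFX (PowerSeries (PowerSeries ℤ_[p])) (IndModule₂ ℤ_[p] p (PrimaryTorsion W.geomPoints p)) :=
    IndModule₂.rfx hA hcofree
  have hm := IndModule₂.hasCorank (p := p) hA hcofree
  have hpD : ∀ d : IndModule₂ ℤ_[p] p (PrimaryTorsion W.geomPoints p), ∃ n : ℕ, (p ^ n : ℤ) • d = 0 :=
    IndModule₂.exists_pow_smul_eq_zero
  -- LOC⁽²⁾: at the finite places from LOC⁽¹⁾ and the free Tate duals; at the complex places trivially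
  haveI := hK.2
  have hKc : ∀ w : InfinitePlace K, w.IsComplex := IsTotallyComplex.isComplex
  obtain ⟨Y, _, _, tA, hY, n, ⟨b⟩⟩ := hTate
  have hLOC2 : ∀ w : Place K, InSigma S w → LOC2 S ρ w := by
    rintro (w | w) hw
    · exact loc2_inl_of_isComplex S ρ w (hKc w)
    · exact loc2_of_loc1_of_free (hLOC1 w ((inSigma_inr_iff S w).mp hw))
        fun Y' _ _ t' hY' ↦ IndModule₂.free_and_finite_of_isDualPairing hA b hY hY'
  -- `corank S_{𝓛_v} = 0` from the torsion input through the parity-free bridge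
  have hSel : HasCorank (IwasawaAlgebra₂ p) (fullAtSpecification S ρ (Sum.inr v)).selmer 0 := by
    obtain ⟨e, he⟩ := exists_addEquiv_unrSelmer₂_balanced_curve_anyPrime W hS κ₁ κ₂ ρ₀ vbar γ₁ γ₂ hK hv
      hvbar hne hNS hρ₀
    exact hasCorank_zero_of_xGr₂_isTorsion W p κ₁ κ₂ vbar γ₁ γ₂ htors e he
  -- LEO and CRK by the squeeze (η = v, η' = v̄ of local degree one; `r₂ = 1`)
  have hr₂ := nrComplexPlaces_eq_one_of_isImaginaryQuadratic hK
  have hdeg : vbar.asIdeal.ramificationIdx ℤ * vbar.asIdeal.inertiaDeg ℤ = 1 :=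
    (ncard_primesOver_eq_two_and_deg_one_of_ne hK.1 hv hvbar hne).2 hvbar
  have hSp : ∀ w : HeightOneSpectrum (𝓞 K), w ∈ S → ((p : ℕ) : 𝓞 K) ∈ w.asIdeal → w = v ∨ w = vbar :=
    fun w _ hw ↦ eq_or_eq_of_natCast_mem_of_ne hK.1 hv hvbar hne hw
  obtain ⟨hLEO, hCRK, -, -⟩ := leo_and_crk_fullAt_of_squeeze ρ h41 h42 h32 h5A hSf hS hKc hr₂ hΛ hpD hcf
    hm h0 (hS vbar hvbar) hne hvbar hdeg hSp hLOC1 h0loc hSel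
  -- Prop. 4.1.1 (c)
  exact fullAtSelmer_isAlmostDivisible_of_facts h411 h422 h5A hSf hS hΛ hinj hfin hcpl hres hchar
    hlin hT hcf hpD hRFX hLEO hLOC2 (hS v hv) (hLOC1 v (hS v hv)) hCRK

/-- **`X_Gr(E/K̃_∞)` has no non-zero pseudo-null `Λ₂`-submodule, EVERY split prime**, under the hypotheses of
`fullAtSelmer_isAlmostDivisible_curve_anyPrime` (end layer
`SignedBaseChangeAcDivFiniteExponent.xGr₂_hasNoPseudoNullSubmodule_of_isAlmostDivisible` through the parity-free
bridge). Twin of `SignedBaseChangeAcDivAssembly.xGr₂_hasNoPseudoNullSubmodule_curve`.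
[cite: Greenberg2016Selmer, §1 p. 2, Prop. 4.1.1 p. 15] [cite: BurungaleCastellaSkinner2025, §2.1 p. 6] -/
theorem xGr₂_hasNoPseudoNullSubmodule_curve_anyPrime
    (h411 : prop411_selmer_isAlmostDivisible) (h422 : prop422_localCohomology_isAlmostDivisible)
    (h5A : sec5A_localH2_subsingleton_of_LOC1) (h41 : prop41_globalEulerPoincareCorank)
    (h42 : prop42_localEulerPoincareCorank) (h32 : prop32_cohomology_isCofinitelyGenerated)
    (hSf : S.Finite) (hK : IsImaginaryQuadratic K)
    {v : HeightOneSpectrum (𝓞 K)} (hv : ((p : ℕ) : 𝓞 K) ∈ v.asIdeal)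
    (hvbar : ((p : ℕ) : 𝓞 K) ∈ vbar.asIdeal) (hne : vbar ≠ v)
    (hNS : ∀ n ∈ ramificationSubgroup K S, ∀ P : PrimaryTorsion W.geomPoints p, n • P = P)
    (hρ₀ : ∀ (σ : absoluteGaloisGroup K) (P : PrimaryTorsion W.geomPoints p),
      ρ₀ (toUnramifiedQuot K S σ) P = σ • P)
    (htors : Module.IsTorsion (IwasawaAlgebra₂ p) (W.XGr₂ p κ₁ κ₂ vbar γ₁ γ₂))
    (hcofree : IsCofree ℤ_[p] (PrimaryTorsion W.geomPoints p))
    (hTate : ∃ (Y : Type) (_ : AddCommGroup Y) (_ : Module ℤ_[p] Y)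
      (tA : Y →+ (PrimaryTorsion W.geomPoints p →+ DiscreteGaloisModule.UnitsCarrier K))
      (_ : IsDualPairing ℤ_[p] (PrimaryTorsion W.geomPoints p) tA) (n : ℕ),
      Nonempty (Module.Basis (Fin n) ℤ_[p] Y))
    (hLOC1 : ∀ w : HeightOneSpectrum (𝓞 K), w ∈ S → LOC1 S (twistDeformation S hS κ₁ κ₂ ρ₀) (Sum.inr w))
    (h0loc : ∀ w : HeightOneSpectrum (𝓞 K), w ∈ S →
      HasCorank (IwasawaAlgebra₂ p) ((localRep S (twistDeformation S hS κ₁ κ₂ ρ₀) (Sum.inr w)).H 0) 0)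
    (h0 : HasCorank (IwasawaAlgebra₂ p) ((twistDeformation S hS κ₁ κ₂ ρ₀).H 0) 0) :
    HasNoPseudoNullSubmodule (IwasawaAlgebra₂ p) (W.XGr₂ p κ₁ κ₂ vbar γ₁ γ₂) := by
  obtain ⟨e, he⟩ := exists_addEquiv_unrSelmer₂_balanced_curve_anyPrime W hS κ₁ κ₂ ρ₀ vbar γ₁ γ₂ hK hv hvbar
    hne hNS hρ₀
  exact xGr₂_hasNoPseudoNullSubmodule_of_isAlmostDivisible W p κ₁ κ₂ vbar γ₁ γ₂
    (fullAtSelmer_isAlmostDivisible_curve_anyPrime W hS κ₁ κ₂ ρ₀ vbar γ₁ γ₂ h411 h422 h5A h41 h42 h32 hSf hK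
      hv hvbar hne hNS hρ₀ htors hcofree hTate hLOC1 h0loc h0) e he

end Assembly

/-! ## §4 The arena chosen inside; the bricks plugged in: no pseudo-null submodule from the six facts ONLY -/

section Facts

variable {K : Type} [Field K] [NumberField K] {p : ℕ} [Fact p.Prime] (W : WeierstrassCurve K)
  [W.IsElliptic] (κ₁ κ₂ : ZpExtension K p) (vbar : HeightOneSpectrum (𝓞 K)) (γ₁ γ₂ : absoluteGaloisGroup K)
  [hγ : Fact (ZpExtension.IsTopGeneratorPair κ₁ κ₂ γ₁ γ₂)]

/-- **`X_Gr(E/K̃_∞)` has no non-zero pseudo-null `Λ₂`-submodule, EVERY split prime**, for an elliptic `W/K` over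
an imaginary quadratic `K` with `p = v v̄` and a generator pair, GRANTED the six PUBLISHED facts, `Λ₂`-torsion of
`X_Gr₂`, (R1a) cofreeness of `E[p^∞]` with a Tate-dual basis and (R1b) LOC_v⁽¹⁾ / `corank H⁰ = 0` for every
admissible `(S, ρ₀)`. The arena (`S = {w ∣ p} ∪` bad places — Néron–Ogg–Shafarevich
`smul_primaryTorsion_eq_of_mem_ramificationSubgroup`; the descended `ρ₀` of `exists_continuousRep_primaryTorsion`;
discrete topologies) is chosen inside. Twin of `SignedBaseChangeAcDivNoPseudoNull.xGr₂_hasNoPseudoNullSubmodule_of_bricks`.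
[cite: Greenberg2016Selmer, Prop. 4.1.1 (c) p. 15, §4.3 pp. 20–21] [cite: Greenberg2006, Thm. 3 p. 342]
[cite: SilvermanAEC2009, VII.4.1, VIII.1 Rem. 1.3] -/
theorem xGr₂_hasNoPseudoNullSubmodule_of_bricks_anyPrime
    (h411 : prop411_selmer_isAlmostDivisible) (h422 : prop422_localCohomology_isAlmostDivisible)
    (h5A : sec5A_localH2_subsingleton_of_LOC1) (h41 : prop41_globalEulerPoincareCorank)
    (h42 : prop42_localEulerPoincareCorank) (h32 : prop32_cohomology_isCofinitelyGenerated)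
    (hK : IsImaginaryQuadratic K)
    {v : HeightOneSpectrum (𝓞 K)} (hv : ((p : ℕ) : 𝓞 K) ∈ v.asIdeal)
    (hvbar : ((p : ℕ) : 𝓞 K) ∈ vbar.asIdeal) (hne : vbar ≠ v)
    (htors : Module.IsTorsion (IwasawaAlgebra₂ p) (W.XGr₂ p κ₁ κ₂ vbar γ₁ γ₂))
    (hcofree : IsCofree ℤ_[p] (PrimaryTorsion W.geomPoints p))
    (hTate : ∃ (Y : Type) (_ : AddCommGroup Y) (_ : Module ℤ_[p] Y)
      (tA : Y →+ (PrimaryTorsion W.geomPoints p →+ DiscreteGaloisModule.UnitsCarrier K))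
      (_ : IsDualPairing ℤ_[p] (PrimaryTorsion W.geomPoints p) tA) (n : ℕ),
      Nonempty (Module.Basis (Fin n) ℤ_[p] Y))
    (hR1b : ∀ [TopologicalSpace (PowerSeries ℤ_[p])] [TopologicalSpace (PowerSeries (PowerSeries ℤ_[p]))]
      [IsTopologicalRing (PowerSeries (PowerSeries ℤ_[p]))]
      [IsTopologicalAddGroup (IndModule₂ ℤ_[p] p (PrimaryTorsion W.geomPoints p))]
      [ContinuousSMul (PowerSeries (PowerSeries ℤ_[p])) (IndModule₂ ℤ_[p] p (PrimaryTorsion W.geomPoints p))]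
      (S : Set (HeightOneSpectrum (𝓞 K)))
      (hS : ∀ w : HeightOneSpectrum (𝓞 K), ((p : ℕ) : 𝓞 K) ∈ w.asIdeal → w ∈ S)
      (ρ₀ : ContinuousRep (GaloisGroupUnramifiedOutside K S) ℤ_[p] (PrimaryTorsion W.geomPoints p)),
      (∀ (σ : absoluteGaloisGroup K) (P : PrimaryTorsion W.geomPoints p), ρ₀ (toUnramifiedQuot K S σ) P = σ • P) →
      (∀ w : HeightOneSpectrum (𝓞 K), w ∈ S → LOC1 S (twistDeformation S hS κ₁ κ₂ ρ₀) (Sum.inr w)) ∧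
      (∀ w : HeightOneSpectrum (𝓞 K), w ∈ S →
        HasCorank (IwasawaAlgebra₂ p) ((localRep S (twistDeformation S hS κ₁ κ₂ ρ₀) (Sum.inr w)).H 0) 0) ∧
      HasCorank (IwasawaAlgebra₂ p) ((twistDeformation S hS κ₁ κ₂ ρ₀).H 0) 0) :
    HasNoPseudoNullSubmodule (IwasawaAlgebra₂ p) (W.XGr₂ p κ₁ κ₂ vbar γ₁ γ₂) := by
  -- the arena: `S = {w ∣ p} ∪ {bad places}`
  set S : Set (HeightOneSpectrum (𝓞 K)) :=
    {w | ((p : ℕ) : 𝓞 K) ∈ w.asIdeal} ∪ W.badPlaces (𝓞 K) with hSdef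
  have hSf : S.Finite :=
    (HeightOneSpectrum.finite_setOf_natCast_mem (Fact.out : p.Prime).ne_zero).union
      (W.finite_badPlaces_holds (𝓞 K))
  have hS : ∀ w : HeightOneSpectrum (𝓞 K), ((p : ℕ) : 𝓞 K) ∈ w.asIdeal → w ∈ S := fun w hw ↦ Or.inl hw
  have hSbad : ∀ w : HeightOneSpectrum (𝓞 K), ¬ W.HasGoodReductionAt w → w ∈ S := fun w hw ↦ Or.inr hw
  have hNS : ∀ n ∈ ramificationSubgroup K S, ∀ P : PrimaryTorsion W.geomPoints p, n • P = P :=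
    fun n hn P ↦ smul_primaryTorsion_eq_of_mem_ramificationSubgroup W p S hSbad hS hn P
  obtain ⟨ρ₀, hρ₀⟩ := exists_continuousRep_primaryTorsion W p S hNS
  -- discrete topologies on `ℤ_p⟦T⟧`, `Λ₂`, hence on `𝐃`
  letI tΛ₁ : TopologicalSpace (PowerSeries ℤ_[p]) := ⊥
  letI tΛ₂ : TopologicalSpace (PowerSeries (PowerSeries ℤ_[p])) := ⊥
  haveI : DiscreteTopology (PowerSeries (PowerSeries ℤ_[p])) := ⟨rfl⟩
  haveI hΛring : IsTopologicalRing (PowerSeries (PowerSeries ℤ_[p])) := inferInstance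
  haveI hDgrp : IsTopologicalAddGroup (IndModule₂ ℤ_[p] p (PrimaryTorsion W.geomPoints p)) := inferInstance
  haveI hDsmul : ContinuousSMul (PowerSeries (PowerSeries ℤ_[p]))
      (IndModule₂ ℤ_[p] p (PrimaryTorsion W.geomPoints p)) := inferInstance
  obtain ⟨hLOC1, h0loc, h0⟩ := hR1b S hS ρ₀ hρ₀
  exact xGr₂_hasNoPseudoNullSubmodule_curve_anyPrime W hS κ₁ κ₂ ρ₀ vbar γ₁ γ₂ h411 h422 h5A h41 h42 h32 hSf hK
    hv hvbar hne hNS hρ₀ htors hcofree hTate hLOC1 h0loc h0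

/-- ★ **`X_Gr(E/K̃_∞)` has no non-zero pseudo-null `Λ₂`-submodule, GRANTED ONLY the six published facts and the
`Λ₂`-torsion of `X_Gr₂` — at EVERY prime `p` split in `K`** (`W/K` elliptic, `K` imaginary quadratic,
`p = v v̄`, `v̄ ≠ v`, a generator pair): `…_of_bricks_anyPrime` with (R1a) supplied by
`SignedBaseChangeAcDivCofree.isCofree_primaryTorsion` / `exists_tateDual_basis_primaryTorsion` and (R1b) by
`SignedBaseChangeAcDivTwistLOC1.loc1_and_hasCorank_H0_zero_curve` (every `S ⊇ {w ∣ p}`, every `ρ₀`). The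
parity-free twin of `SignedBaseChangeAcDivNoPseudoNullOfFacts.xGr₂_hasNoPseudoNullSubmodule_of_facts`; at
`p = 2` it is piece P1 PURITY₂ of O2's node `residual-selmer-control-two` modulo PRINT (file
`TwoAdicConverseBDPSelmerLowerDivisibilityAtTwoPurity`). The six facts: Greenberg 2016 Prop. 4.1.1
(`prop411_selmer_isAlmostDivisible`), Prop. 4.2.2 (`prop422_localCohomology_isAlmostDivisible`); Greenberg 2006
§5 A (`sec5A_localH2_subsingleton_of_LOC1`), Prop. 4.1 (`prop41_globalEulerPoincareCorank`), Prop. 4.2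
(`prop42_localEulerPoincareCorank`), Prop. 3.2 (`prop32_cohomology_isCofinitelyGenerated`).
[cite: Greenberg2016Selmer, Prop. 4.1.1 (c) (§4.1 p. 15), §4.3 pp. 20–21, p. 18 L4–16]
[cite: Greenberg2006, Thm. 3 p. 342, p. 341 L24 ("We allow p to be any prime")]
[cite: Greenberg2010, Lemma 5.2.2 (PDF p. 28 L20–21)] -/
theorem xGr₂_hasNoPseudoNullSubmodule_of_facts_anyPrime
    (h411 : prop411_selmer_isAlmostDivisible) (h422 : prop422_localCohomology_isAlmostDivisible)
    (h5A : sec5A_localH2_subsingleton_of_LOC1) (h41 : prop41_globalEulerPoincareCorank)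
    (h42 : prop42_localEulerPoincareCorank) (h32 : prop32_cohomology_isCofinitelyGenerated)
    (hK : IsImaginaryQuadratic K)
    {v : HeightOneSpectrum (𝓞 K)} (hv : ((p : ℕ) : 𝓞 K) ∈ v.asIdeal)
    (hvbar : ((p : ℕ) : 𝓞 K) ∈ vbar.asIdeal) (hne : vbar ≠ v)
    (htors : Module.IsTorsion (IwasawaAlgebra₂ p) (W.XGr₂ p κ₁ κ₂ vbar γ₁ γ₂)) :
    HasNoPseudoNullSubmodule (IwasawaAlgebra₂ p) (W.XGr₂ p κ₁ κ₂ vbar γ₁ γ₂) :=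
  xGr₂_hasNoPseudoNullSubmodule_of_bricks_anyPrime W κ₁ κ₂ vbar γ₁ γ₂ h411 h422 h5A h41 h42 h32 hK hv hvbar hne
    htors (isCofree_primaryTorsion W p) (exists_tateDual_basis_primaryTorsion W p)
    fun S hS ρ₀ _ ↦ by
      obtain ⟨h1, h0, h00⟩ := loc1_and_hasCorank_H0_zero_curve W κ₁ κ₂ hK hγ.out S hS ρ₀
      exact ⟨fun w _ ↦ h1 w, fun w _ ↦ h0 w, h00⟩

/-- The dual reading of ★, unfolded: under the same hypotheses EVERY pseudo-null `Λ₂`-submodule `N` of `X_Gr₂`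
is `⊥`. [cite: Greenberg2016Selmer, §1 p. 2 L31–35, Prop. 4.1.1 (c) p. 15] -/
theorem xGr₂_eq_bot_of_isPseudoNull_of_facts_anyPrime
    (h411 : prop411_selmer_isAlmostDivisible) (h422 : prop422_localCohomology_isAlmostDivisible)
    (h5A : sec5A_localH2_subsingleton_of_LOC1) (h41 : prop41_globalEulerPoincareCorank)
    (h42 : prop42_localEulerPoincareCorank) (h32 : prop32_cohomology_isCofinitelyGenerated)
    (hK : IsImaginaryQuadratic K)
    {v : HeightOneSpectrum (𝓞 K)} (hv : ((p : ℕ) : 𝓞 K) ∈ v.asIdeal)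
    (hvbar : ((p : ℕ) : 𝓞 K) ∈ vbar.asIdeal) (hne : vbar ≠ v)
    (htors : Module.IsTorsion (IwasawaAlgebra₂ p) (W.XGr₂ p κ₁ κ₂ vbar γ₁ γ₂))
    (N : Submodule (IwasawaAlgebra₂ p) (W.XGr₂ p κ₁ κ₂ vbar γ₁ γ₂))
    (hN : Module.IsPseudoNull (IwasawaAlgebra₂ p) N) : N = ⊥ :=
  xGr₂_hasNoPseudoNullSubmodule_of_facts_anyPrime W κ₁ κ₂ vbar γ₁ γ₂ h411 h422 h5A h41 h42 h32 hK hv hvbar hne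
    htors N hN

end Facts

end Summit.BirchSwinnertonDyer.BirchSwinnertonDyer.Theorems.TwoAdicBDPPurity

end
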